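import Summits.ABC.IUTFork.Cor312ProvKIdeles
import Literature.IUT.LogVolume.InitialThetaDataBadPlaceRamification
import Literature.IUT.LogVolume.DifferentEstimatesCorollaries
import Literature.IUT.LogVolume.RescaledCompletionInvariants
import Literature.IUT.LogVolume.Corollary22TwoAdicIntegrality
import HarnessLib

/-!
# [IUTchIII] Cor. 3.12 at the genuine `K`-level setting — the LOCAL ARITHMETIC of a bad place of `K` that the explicit
# deep-packet criterion consumes: the realising q-idele as an explicit power of `p`, its exponent over the absolute
# ramification index, and the [IUTchIV] Prop. 1.2 constants `d + a + b` of a TAME factor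

PROOF-ONLY support file (D-0012; 0 definitions, 0 `Prop` facts) of the abc-iut cell (Cor. 3.12 sub-crew seat abc-iut-c312-7,
gen 4; row «V6-HSH-FAMILY-VACUITY», piece F1 «local arithmetic»). TAKES NO SIDE on [IUTchIII] Cor. 3.12 (S. Mochizuki,
*Inter-universal Teichmüller theory III*, RIMS manuscript, Cor. 3.12 p. 173–174) or on any author: classical valuation
theory on the cell's typed objects.

CONTEXT. Branch C's certificate v6 (`Conditional.abc_of_SH_v6K`, abc-iut-C-cert-1) reads the hull-level clause S_H at
abc-iut-c312-7's print-normalised sharp real setting `Real.settingPrVolSharp (pilotDataOfK T.D T.K) …` over the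
`K`-LEVEL Dupuy–Hilado pilot datum (abc-iut-C-cert-3 `Cor312Prov.pilotDataOfK`, [IUTchI] Def. 3.1 (c) `K = F(E_F[l])`) with
REALISING pilot ideles (they exist: `Cor312Prov.exists_realising_qIdeles_pilotDataOfK`, [IUTchI] Ex. 3.2 (iv)). abc-iut-w4-d092's
explicit deep-packet criterion (`Cor312LicenceExplicitDepth`, [IUTchIV] Prop. 1.2 (i)(ii)) refutes the (xi-f) licence there as
soon as, at ONE bad place `x₀ | p` and a label `i₀+1`, `‖t_{q,x₀}‖ = p^{−m_q/e}` and
`d_I + a_I + b_I + 2(i₀+2) + 1 ≤ ((i₀+1)² − 1)·m_q/e` for the diagonal packet `(K_{x₀})^{⊗(i₀+2)}`. THIS FILE supplies the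
three local inputs, generically:

* §1 `Cor312Prov.norm_eq_rpow_of_log_norm_eq` — in the rescaled completion `K_w = kOf X p x` (abc-iut-S7's
  `RescaledCompletion`, norm `|·|_w^{1/n_w}`), an element with `log ‖a‖ = −c·ln|κ(w)|/n_w` (Dupuy–Hilado's normalisation
  (3.4), the shape of abc-iut-c312-7's realising binders `htq`/`ht`) has `‖a‖ = p^{−c/e(w|p)}` with `e(w|p)` the
  norm-defined `absRamificationIdx p K_w` (abc-iut-S7 `absRamificationIdx_rescaledCompletion`);
* §2 at the `K`-level pilot datum of an initial Θ-datum `D` (`L := K`): for a realising q-idele and a bad place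
  `w = placeOf X p x ∈ S`, `‖t_{q,w}‖ = p^{−m/e(w|p)}` with the INTEGER `m = ord_w(q)/(2l)` (`2l ∣ ord_w(q)`:
  `Cor312Prov.twoMulLDvdOrdq_pilotDataOfK`, [IUTchI] Ex. 3.2 (iv) valuation half) — `Cor312Prov.exists_int_norm_qIdele_pilotDataOfK` —
  and the exponent in print's currency: `m/e(w|p) = ord_v(q_v)/(2l·e(v|p))` for `v = w ∩ F` (`ord_w(q) = e(w|v)·ord_v(q_v)`,
  `e(w|p) = e(v|p)·e(w|v)`; abc-iut-w5-d009 `absRamificationIdx_eq_ramIdx_mul`) — `Cor312Prov.qExponent_div_eq_pilotDataOfK`;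
* §3 for a `p`-adic field `K'` (`p ≥ 5`) TAMELY ramified over `ℚ_p` (`p ∤ e`): `d + a + b ≤ 2 + log(e)/log(p)` for the
  [IUTchIV] Prop. 1.1/1.2 constants `d = (e−1)/e` (abc-iut-L5-t15 `differentOrd_eq_of_not_dvd`, Serre *Corps locaux* III §6
  Prop. 13), `a = ⌈e/(p−2)⌉/e`, `b = ⌊log(pe/(p−1))/log p⌋ − 1/e` (campaign-S `logRadiusA`/`logRadiusB`) —
  `differentOrd_add_logRadius_le_of_not_dvd`; sharper than the degree-only bound `d + a + b < 4 + 2·log_p[K:ℚ_p]` of abc-iut-C-cert-1's `DepthConstantsBound` (brick (H3)) at a tame place — and the constant-family sums `d_I + a_I + b_I ≤ |I|·(2 + log(e)/log(p))`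
  (`dSum_add_aSum_add_bSum_const_le`).

HONEST FRAMING: bookkeeping over OUR typed objects; nothing here bears on the printed inequality of [IUTchIII] Cor. 3.12
or on the number-level `Cor22.Cor312AtDatum`; typed ≠ proved; instantiated ≠ endorsed.
[cite: Mochizuki2012, IUTchI Def. 3.1 (c) p. 62, Ex. 3.2 (iv) p. 71; IUTchIV Prop. 1.1 p. 9, Prop. 1.2 p. 10]
[cite: DupuyHilado2025, §2.4.2, §3.3, §3.4] [cite: SerreLocalFields1979, Ch. III §6 Prop. 13]
[claim: Mochizuki2012, status: disputed] for every IUT quotation.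
-/

noncomputable section

open NumberField IsDedekindDomain

/-! ## §3 (stated first, field-generic). The Prop. 1.2 constants of a tame factor -/

namespace Literature.IUT.LogVolume

section Tame

variable (p : ℕ) [Fact p.Prime] (K' : Type) [NontriviallyNormedField K'] [NormedAlgebra ℚ_[p] K']
  [IsUltrametricDist K'] [ProperSpace K']

omit [Fact p.Prime] in
/-- `log(p−1)/log(p) ≥ 1/3` for a prime `p ≥ 3` (since `(p−1)³ ≥ p`). [folklore] -/
theorem one_div_three_le_log_pred_div_log (hp3 : 3 ≤ p) :
    (1 : ℝ) / 3 ≤ Real.log ((p : ℝ) - 1) / Real.log p := by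
  have hp1 : (1 : ℝ) < p := by exact_mod_cast (lt_of_lt_of_le (by norm_num) hp3 : 1 < p)
  have hlogp : 0 < Real.log p := Real.log_pos hp1
  have h2 : (2 : ℝ) ≤ (p : ℝ) - 1 := by
    have : (3 : ℝ) ≤ p := by exact_mod_cast hp3
    linarith
  rw [div_le_div_iff₀ (by norm_num : (0 : ℝ) < 3) hlogp, one_mul]
  have h3 : Real.log (((p : ℝ) - 1) ^ 3) = 3 * Real.log ((p : ℝ) - 1) := by
    rw [Real.log_pow]; norm_num
  calc Real.log (p : ℝ) ≤ Real.log (((p : ℝ) - 1) ^ 3) := by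
        apply Real.log_le_log (by positivity)
        nlinarith [h2, sq_nonneg ((p : ℝ) - 1)]
    _ = Real.log ((p : ℝ) - 1) * 3 := by rw [h3, mul_comm]

omit [Fact p.Prime] in
/-- `a = ⌈e/(p−2)⌉/e ≤ 1/(p−2) + 1/e` for `p > 2`. [claim: Mochizuki2012, status: disputed] -/
theorem logRadiusA_le (hp2 : 2 < p) {e : ℕ} (he : 0 < e) :
    logRadiusA p e ≤ 1 / ((p : ℝ) - 2) + 1 / e := by
  have hp2' : (0 : ℝ) < (p : ℝ) - 2 := by
    have : (2 : ℝ) < p := by exact_mod_cast hp2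
    linarith
  have he' : (0 : ℝ) < e := by exact_mod_cast he
  rw [logRadiusA, if_neg (by omega)]
  have hceil : (⌈(e : ℝ) / ((p : ℝ) - 2)⌉ : ℝ) ≤ (e : ℝ) / ((p : ℝ) - 2) + 1 :=
    (Int.ceil_lt_add_one _).le
  calc (⌈(e : ℝ) / ((p : ℝ) - 2)⌉ : ℝ) / e ≤ ((e : ℝ) / ((p : ℝ) - 2) + 1) / e :=
        div_le_div_of_nonneg_right hceil he'.le
    _ = 1 / ((p : ℝ) - 2) + 1 / e := by field_simp

omit [Fact p.Prime] in
/-- `b = ⌊log(pe/(p−1))/log p⌋ − 1/e ≤ 1 + log(e)/log(p) − log(p−1)/log(p) − 1/e`. [claim: Mochizuki2012, status: disputed] -/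
theorem logRadiusB_le_sharp (hp2 : 2 < p) {e : ℕ} (he : 0 < e) :
    logRadiusB p e ≤ 1 + Real.log e / Real.log p - Real.log ((p : ℝ) - 1) / Real.log p - 1 / e := by
  have hp1 : (1 : ℝ) < p := by exact_mod_cast (lt_trans (by norm_num) hp2 : 1 < p)
  have hlogp : 0 < Real.log p := Real.log_pos hp1
  have hp0 : (0 : ℝ) < p := by positivity
  have hp1' : (0 : ℝ) < (p : ℝ) - 1 := by linarith
  have he' : (0 : ℝ) < e := by exact_mod_cast he
  have hlog : Real.log ((p : ℝ) * e / ((p : ℝ) - 1)) = Real.log p + Real.log e - Real.log ((p : ℝ) - 1) := by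
    rw [Real.log_div (by positivity) hp1'.ne', Real.log_mul hp0.ne' he'.ne']
  rw [logRadiusB, hlog]
  have hfl : (⌊(Real.log p + Real.log e - Real.log ((p : ℝ) - 1)) / Real.log p⌋ : ℝ) ≤
      (Real.log p + Real.log e - Real.log ((p : ℝ) - 1)) / Real.log p := Int.floor_le _
  have : (Real.log p + Real.log e - Real.log ((p : ℝ) - 1)) / Real.log p =
      1 + Real.log e / Real.log p - Real.log ((p : ℝ) - 1) / Real.log p := by
    field_simp
  linarith

/-- **`d + a + b ≤ 2 + log(e)/log(p)` for a TAME `p`-adic field, `p ≥ 5`**: `d = (e−1)/e` (`p ∤ e`, Serre III §6 Prop. 13),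
`a ≤ 1/(p−2) + 1/e`, `b ≤ 1 + log(e)/log(p) − log(p−1)/log(p) − 1/e`, and `1/(p−2) ≤ 1/3 ≤ log(p−1)/log(p)`. These are the
per-factor [IUTchIV] Prop. 1.1/1.2 constants of the log-shell sandwich. [cite: Mochizuki2012, IUTchIV Prop. 1.2 p. 10]
[cite: SerreLocalFields1979, Ch. III §6 Prop. 13] [claim: Mochizuki2012, status: disputed] -/
theorem differentOrd_add_logRadius_le_of_not_dvd (hp5 : 5 ≤ p) (htame : ¬ p ∣ absRamificationIdx p K') :
    differentOrd p K' + logRadiusA p (absRamificationIdx p K') + logRadiusB p (absRamificationIdx p K') ≤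
      2 + Real.log (absRamificationIdx p K') / Real.log p := by
  set e := absRamificationIdx p K' with he_def
  have he : 0 < e := absRamificationIdx_pos p K'
  have he' : (0 : ℝ) < e := by exact_mod_cast he
  have hp2 : 2 < p := by omega
  have hd : differentOrd p K' = ((e : ℝ) - 1) / e := differentOrd_eq_of_not_dvd p K' htame
  have ha := logRadiusA_le p hp2 he
  have hb := logRadiusB_le_sharp p hp2 he
  have h3 := one_div_three_le_log_pred_div_log p (by omega)
  have hp2' : (1 : ℝ) / ((p : ℝ) - 2) ≤ 1 / 3 := by
    have : (5 : ℝ) ≤ p := by exact_mod_cast hp5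
    rw [div_le_div_iff₀ (by linarith) (by norm_num : (0 : ℝ) < 3)]
    linarith
  have hd' : ((e : ℝ) - 1) / e = 1 - 1 / e := by field_simp
  have h1e : (0 : ℝ) < 1 / e := by positivity
  rw [hd, hd']
  linarith

/-- **Constant families**: for the diagonal packet `(K')^{⊗ I}` (every factor the same tame field), the sums
`d_I + a_I + b_I = |I|·(d + a + b) ≤ |I|·(2 + log(e)/log(p))`. [cite: Mochizuki2012, IUTchIV Prop. 1.2 p. 10]
[claim: Mochizuki2012, status: disputed] -/
theorem dSum_add_aSum_add_bSum_const_le {I : Type} [Fintype I] [DecidableEq I] (hp5 : 5 ≤ p)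
    (htame : ¬ p ∣ absRamificationIdx p K') :
    dSum p (fun _ : I => K') + aSum p (fun _ : I => K') + bSum p (fun _ : I => K') ≤
      (Fintype.card I : ℝ) * (2 + Real.log (absRamificationIdx p K') / Real.log p) := by
  have h := differentOrd_add_logRadius_le_of_not_dvd p K' hp5 htame
  simp only [dSum, aSum, bSum, Finset.sum_const, Finset.card_univ, nsmul_eq_mul]
  have hc : (0 : ℝ) ≤ Fintype.card I := Nat.cast_nonneg _
  nlinarith

end Tame

end Literature.IUT.LogVolume

/-! ## §1. Norms in the rescaled completions from the realising log-identity -/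

namespace Summit.ABC.IUTFork.Cor312Prov

open Thm311 Thm311.Real Cor312 Literature.IUT.LogVolume Literature.IUT.HodgeTheaters Literature.IUT.LogThetaLattice
  Literature.NumberTheory.NumberFields

section Generic

variable {L : Type} [Field L] [NumberField L] (X : PilotData L) (pp : Nat.Primes)

/-- **`‖a‖ = p^{−c/e(w|p)}` from `log ‖a‖ = −c·ln|κ(w)|/n_w`** in the rescaled completion `K_w = kOf X p x` (`w = placeOf X p x`):
`ln|κ(w)| = f_w·log p`, `n_w = e_w·f_w` and `e_w = e(w|p)` is the norm-defined absolute ramification index of `K_w`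
(abc-iut-S7 `absRamificationIdx_rescaledCompletion`). The conversion from Dupuy–Hilado's normalisation (3.4) of the realising
binders to the `p`-power form of abc-iut-w4-d092's explicit criterion. [cite: DupuyHilado2025, §2.4.2, §3.4] -/
theorem norm_eq_rpow_of_log_norm_eq (x : (thetaIndex X).Fibre (.inr pp))
    {a : haveI : Fact (pp : ℕ).Prime := ⟨pp.2⟩; kOf X pp.1 x} (ha : a ≠ 0) {c : ℝ}
    (h : haveI : Fact (pp : ℕ).Prime := ⟨pp.2⟩
      Real.log ‖a‖ = -c * logNorm L (placeOf X pp.1 x) / localDegree L (placeOf X pp.1 x)) :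
    haveI : Fact (pp : ℕ).Prime := ⟨pp.2⟩
    ‖a‖ = ((pp : ℕ) : ℝ) ^ (-(c / absRamificationIdx (pp : ℕ) (kOf X pp.1 x))) := by
  haveI : Fact (pp : ℕ).Prime := ⟨pp.2⟩
  have hpw : ((pp : ℕ) : 𝓞 L) ∈ (placeOf X pp.1 x).asIdeal := natCast_mem_placeOf X pp.1 x
  have hp0 : (0 : ℝ) < ((pp : ℕ) : ℝ) := by exact_mod_cast pp.2.pos
  have hpos : 0 < ‖a‖ := norm_pos_iff.mpr ha
  have he : (absRamificationIdx (pp : ℕ) (kOf X pp.1 x) : ℝ) = ramIdx L (placeOf X pp.1 x) := by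
    rw [show absRamificationIdx (pp : ℕ) (kOf X pp.1 x) =
        absRamificationIdx (pp : ℕ) (RescaledCompletion L pp.1 (placeOf X pp.1 x) hpw) from rfl,
      absRamificationIdx_rescaledCompletion L pp.1 (placeOf X pp.1 x) hpw, ← ramIdx_eq]
  have hf : (resDeg L (placeOf X pp.1 x) : ℝ) ≠ 0 := by exact_mod_cast resDeg_ne_zero L (placeOf X pp.1 x)
  have he0 : (ramIdx L (placeOf X pp.1 x) : ℝ) ≠ 0 := by exact_mod_cast ramIdx_ne_zero L (placeOf X pp.1 x)
  have hlog : Real.log ‖a‖ = -(c / absRamificationIdx (pp : ℕ) (kOf X pp.1 x)) * Real.log ((pp : ℕ) : ℝ) := by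
    rw [h, logNorm_eq, localDegree, residueChar_eq_of_natCast_mem pp.1 hpw, he]
    push_cast
    field_simp
  rw [Real.rpow_def_of_pos hp0, mul_comm, ← hlog, Real.exp_log hpos]

end Generic

/-! ## §2. At the `K`-level pilot datum of an initial Θ-datum: integer exponent and its value over `e(w|p)` -/

section Genuine

variable {F K Fbar : Type} [Field F] [NumberField F] [Field K] [NumberField K] [Algebra F K] [Field Fbar]
  [Algebra F Fbar] [Algebra K Fbar] {E : WeierstrassCurve F} [E.IsElliptic] {l : ℕ} {Pb : BadPlacePredicates K}
  (D : InitialThetaData F K Fbar E l Pb) (pp : Nat.Primes)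

/-- **The realising q-idele at a bad place of `K` is an explicit power of `p`**: for q-ideles realising `P_q` of the `K`-level
pilot datum `pilotDataOfK D K` (abc-iut-c312-7's binder `htq`) and `x` in the fibre over `p` with `w = placeOf x ∈ S`, there is an
INTEGER `m` with `ord_w(q) = 2l·m` ([IUTchI] Ex. 3.2 (iv), `twoMulLDvdOrdq_pilotDataOfK`) and `‖t_{q,w}‖ = p^{−m/e(w|p)}` — the
hypothesis `hq` of abc-iut-w4-d092's `not_exists_qPinned_hull_settingPrVolSharp_of_realising_explicit`.
[cite: Mochizuki2012, IUTchI Ex. 3.2 (iv) p. 71] [cite: DupuyHilado2025, §3.3, §3.4] -/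
theorem exists_int_norm_qIdele_pilotDataOfK
    (tq : ∀ (pp : Nat.Primes) (x : (thetaIndex (pilotDataOfK D K)).Fibre (.inr pp)),
      haveI : Fact (pp : ℕ).Prime := ⟨pp.2⟩; kOf (pilotDataOfK D K) pp.1 x)
    (htq0 : ∀ pp x, tq pp x ≠ 0)
    (htq : ∀ (pp : Nat.Primes) (x : (thetaIndex (pilotDataOfK D K)).Fibre (.inr pp)),
      haveI : Fact (pp : ℕ).Prime := ⟨pp.2⟩
      Real.log ‖tq pp x‖ = -((pilotDataOfK D K).qPilot (placeOf (pilotDataOfK D K) pp.1 x)) *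
        logNorm K (placeOf (pilotDataOfK D K) pp.1 x) / localDegree K (placeOf (pilotDataOfK D K) pp.1 x))
    (x : (thetaIndex (pilotDataOfK D K)).Fibre (.inr pp))
    (hx : haveI : Fact (pp : ℕ).Prime := ⟨pp.2⟩; placeOf (pilotDataOfK D K) pp.1 x ∈ (pilotDataOfK D K).S) :
    ∃ m : ℤ, (haveI : Fact (pp : ℕ).Prime := ⟨pp.2⟩; (pilotDataOfK D K).ordq (placeOf (pilotDataOfK D K) pp.1 x) = 2 * l * m) ∧
      (haveI : Fact (pp : ℕ).Prime := ⟨pp.2⟩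
       ‖tq pp x‖ = ((pp : ℕ) : ℝ) ^ (-((m : ℝ) / absRamificationIdx (pp : ℕ) (kOf (pilotDataOfK D K) pp.1 x)))) := by
  haveI : Fact (pp : ℕ).Prime := ⟨pp.2⟩
  obtain ⟨m, hm⟩ := twoMulLDvdOrdq_pilotDataOfK D _ hx
  refine ⟨m, by simpa using hm, ?_⟩
  have hq : (pilotDataOfK D K).qPilot (placeOf (pilotDataOfK D K) pp.1 x) = m := by
    rw [(pilotDataOfK D K).qPilot_apply_of_mem hx, hm, pilotDataOfK_l]
    have hl : (l : ℝ) ≠ 0 := by exact_mod_cast (pilotDataOfK D K).l_prime.ne_zero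
    push_cast
    field_simp
  have h := htq pp x
  rw [hq] at h
  exact norm_eq_rpow_of_log_norm_eq (pilotDataOfK D K) pp x (htq0 pp x) h

/-- **The exponent in print's currency**: at a bad place `w = placeOf x` of `K` over `v = w ∩ F ∈ 𝕍(F)^bad`, the integer `m` with
`ord_w(q) = 2l·m` satisfies `m/e(w|p) = ord_v(q_v)/(2l·e(v|p))` — `ord_w(q) = e(w|v)·ord_v(q_v)` (`Cor312Prov.ordq_pilotDataOfK`) and
`e(w|p) = e(v|p)·e(w|v)` (abc-iut-w5-d009 `ThetaData.absRamificationIdx_eq_ramIdx_mul`); `ord_v(q_v) = qParamOrd E v` (abc-iut-L5-t2).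
The relative index `e(w|v) (≥ l)` CANCELS: the depth of the q-pilot at `w` over the log-shell scale of `K_w` is that of `q_v` over `F_v`.
[cite: Mochizuki2012, IUTchI Def. 3.1 (c) p. 62; IUTchIV Cor. 2.2 (P2) p. 45] [cite: NeukirchANT1999, Ch. II Prop. (6.8)] -/
theorem qExponent_div_eq_pilotDataOfK (x : (thetaIndex (pilotDataOfK D K)).Fibre (.inr pp))
    (hx : haveI : Fact (pp : ℕ).Prime := ⟨pp.2⟩; placeOf (pilotDataOfK D K) pp.1 x ∈ (pilotDataOfK D K).S) {m : ℤ}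
    (hm : haveI : Fact (pp : ℕ).Prime := ⟨pp.2⟩; (pilotDataOfK D K).ordq (placeOf (pilotDataOfK D K) pp.1 x) = 2 * l * m) :
    haveI : Fact (pp : ℕ).Prime := ⟨pp.2⟩
    (m : ℝ) / absRamificationIdx (pp : ℕ) (kOf (pilotDataOfK D K) pp.1 x) =
      (qParamOrd E (finBelow F K (placeOf (pilotDataOfK D K) pp.1 x)) : ℝ) /
        (2 * l * ramIdx F (finBelow F K (placeOf (pilotDataOfK D K) pp.1 x))) := by
  haveI : Fact (pp : ℕ).Prime := ⟨pp.2⟩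
  have hpw : ((pp : ℕ) : 𝓞 K) ∈ (placeOf (pilotDataOfK D K) pp.1 x).asIdeal := natCast_mem_placeOf (pilotDataOfK D K) pp.1 x
  -- `e(w|p)` as the product `e(v|p)·e(w|v)`
  have he : (absRamificationIdx (pp : ℕ) (kOf (pilotDataOfK D K) pp.1 x) : ℝ) =
      (ramIdx F (finBelow F K (placeOf (pilotDataOfK D K) pp.1 x)) : ℝ) *
        Ideal.ramificationIdx' (finBelow F K (placeOf (pilotDataOfK D K) pp.1 x)).asIdeal
          (placeOf (pilotDataOfK D K) pp.1 x).asIdeal := by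
    rw [show absRamificationIdx (pp : ℕ) (kOf (pilotDataOfK D K) pp.1 x) =
        absRamificationIdx (pp : ℕ) (RescaledCompletion K pp.1 (placeOf (pilotDataOfK D K) pp.1 x) hpw) from rfl,
      absRamificationIdx_rescaledCompletion K pp.1 (placeOf (pilotDataOfK D K) pp.1 x) hpw,
      ThetaData.absRamificationIdx_eq_ramIdx_mul (F := F) (placeOf (pilotDataOfK D K) pp.1 x)]
    push_cast
    rfl
  -- `ord_w(q) = e(w|v)·qParamOrd E v`
  have hord := ordq_pilotDataOfK D K hx
  rw [hm] at hord
  have hl : (l : ℝ) ≠ 0 := by exact_mod_cast (pilotDataOfK D K).l_prime.ne_zero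
  have he0 : (ramIdx F (finBelow F K (placeOf (pilotDataOfK D K) pp.1 x)) : ℝ) ≠ 0 := by
    exact_mod_cast ramIdx_ne_zero F (finBelow F K (placeOf (pilotDataOfK D K) pp.1 x))
  have hrel : (Ideal.ramificationIdx' (finBelow F K (placeOf (pilotDataOfK D K) pp.1 x)).asIdeal
      (placeOf (pilotDataOfK D K) pp.1 x).asIdeal : ℝ) ≠ 0 := by
    exact_mod_cast Ideal.IsDedekindDomain.ramificationIdx'_ne_zero_of_liesOver (placeOf (pilotDataOfK D K) pp.1 x).asIdeal
      (finBelow F K (placeOf (pilotDataOfK D K) pp.1 x)).ne_bot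
  have hord' : (2 * (l : ℝ) * m) =
      (Ideal.ramificationIdx' (finBelow F K (placeOf (pilotDataOfK D K) pp.1 x)).asIdeal
          (placeOf (pilotDataOfK D K) pp.1 x).asIdeal : ℝ) *
        (qParamOrd E (finBelow F K (placeOf (pilotDataOfK D K) pp.1 x)) : ℝ) := by exact_mod_cast hord
  rw [he, div_eq_div_iff (mul_ne_zero he0 hrel) (mul_ne_zero (mul_ne_zero two_ne_zero hl) he0)]
  nlinarith [hord']

end Genuine

end Summit.ABC.IUTFork.Cor312Prov

end
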